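import Literature.MathematicalPhysics.QuantumFieldTheory.Balaban1983to89.B3Ineq210RegularRegion

/-!
# `Balaban1983to89.B3Ineq212VectorTorus` — T. Bałaban, *(Higgs)₂,₃ quantum fields in a finite volume. III. Renormalization*,
# Commun. Math. Phys. **88** (1983) 411–445 [Balaban1983Higgs3]: the bound (2.12) p. 426 for the VECTOR-FIELD propagator `G_k`
# with a leg averaged along the composite contours `Γ^{(j+1)}_{x_{j+1},x}` of [Balaban1982Higgs1] (2.1)–(2.2),
# `|G^η_{(j)}(Γ^{(j+1)}_{x_{j+1},x}, b)| ≤ O(1)(L^jη)^{−d+3}e^{−δ₁(L^jη)^{−1}dist(B^j(x),b)}` («an additional factor L^jη»), PROVED on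
# print's torus `T_ε` of [Balaban1982Higgs1] (1.2) in the GENERAL volume family `HiggsLattice.Params` (every block size `L ≥ 2`,
# every `ε, K, M, L′_μ`), together with (2.10) for the same carrier

statement-level skeleton of published theorems with citation tags; proofs where landed; nothing here is a claim about the Yang–Mills mass gap

PDF held: `paper:balaban1983-higgs-2-3-quantum-fields-finite-volume` (journal page = PDF page + 410); pp. 414–416 [PDF 4–6] and
p. 426 [PDF 16] read in the OCR text (`p0004.txt`–`p0006.txt`, `p0016.txt`) and (2.12) on the render
`run/shared/lean/pub/pub-balaban/b2b-balaban-ref1/pages/1983-cmp88-higgs23-III/1983-cmp88-higgs23-III-p016-x2.png`; [B1] = T. Bałaban,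
*(Higgs)₂,₃ quantum fields in a finite volume. I*, CMP **85** (1982) 603–636 [Balaban1982Higgs1] (`paper:balaban1982-cmp85-higgs23-i`),
pp. 604–608 [PDF 2–6] ((1.2), (1.11), (2.1)–(2.3)).

CITATION HEADER (lean-in-tree rule).  Part of the lit-balaban TYPED SKELETON (HOME `run/shared/lean/pub/lit-balaban/`), Phase 2:
SKELETON row **B3.Eq2.12** (`HOME/lit-balaban-r15/ROWS-B3.md`, fold owner r15; decl of record
`B3Sect2StatementsPart2.ScaledKernels.Ineq212`, typed p239134, over the ABSTRACT carrier `ScaledKernels`).  Third member of the row after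
p03 g4's `B3Ineq212ZeroBox` (Neumann box, p254210) and `B3Ineq212ZeroTorus` (the scalar torus tower `Setup.Params`: odd `L`, `L_μ = L^m`,
hypothesis-free, p259522).  THIS file: the same printed inequality on the tree's GENERAL finite-volume lattice of [B1] (1.2)
(`HiggsLattice.Params`: *"K, L, M, L′_μ are some positive integers"* — every `L ≥ 2` including even `L`, every side `2L^KML′_μ`), as a thin
assembly over (a) r14 g17's **(2.10) on regions** `B3Ineq210RegularRegion.ineq210_regularRegion_explicit` (p340643) read at
`Ω = T_ε`, `A = 0`, and (b) the tree's OWN composite contours of [B1] (2.1)–(2.2): the functional `HiggsAveraging.multiContourSum`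
(`A ↦ A(Γ^{(k)}_{x_k,x})`) and its geometry `B2Ineq329PrismHolonomy.abs_multiContourSum_le` / `sum_steps_le` / `blockIter_stair_src`
(bound by the number of bonds, length `≤ d(L^k − 1)`, the bonds start in `B^k(x_k)`); nothing of these is re-proved.

WHAT IS PRINTED.  B3 p. 426 [PDF 16], verbatim: *"Of course the same inequalities hold for vector field propagators, but we have to
estimate some additional expressions also. If a leg A′ of the line is in one of the vertices (1.14) and (1.15), then we have the
expression A′^{(j),η}(Γ^{j+1}_{x_{j+1},x}) on the basis of (1.3). For each such expression we have an additional factor L^jη on the right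
side, e.g. we have |G^η_{(j)}(Γ^{(j+1)}_{x_{j+1},x}, b)| ≤ O(1)(L^jη)^{−d+3}e^{−δ₁(L^jη)^{−1}dist(B^j(x),b)}. (2.12)"*.  WHICH PROPAGATOR: the display
(2.12) carries no `(Ω, B̃)` arguments (compare (2.10) `G^η_{(j)}(Ω, B̃; x, x′)`); p. 414 [PDF 4]: *"From the formula (1.4) it follows that
A′_j are independent Gaussian fields with covariances C^{(j)}_{L^jη}. The formulas (1.1) and (1.2) and the basic composition formula (I.2.43)
imply that the field A′ has the covariance G_k. The basic propagator for the scalar field φ′ is G_k(Ω, B̃)"*; p. 415 legend: *"the scalar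
field propagator G_k(Ω, B̃)"* / *"the vector field propagator G_k"*; p. 416: *"C^ε = (−Δ^ε + μ₀²)^{−1} for the vector field (of course
internal indices and vector indices are understood here)"*; [B1] p. 608: *"The renormalization transformations for vector fields will be
obtained by taking N = d and an external vector field A = 0"*, p. 605: *"We will assume that μ₀² > 0 and λ > 0"*.  So the vector-field
propagator of (2.12) is the torus propagator `G_k = G^ε_k(T_ε, 0)` of the `N = d` field at zero background with a POSITIVE mass, and its
scale pieces `G^η_{(j)}` are those of (2.6) = (I.2.43) for that operator (p. 424: *"and the similar equality for the vector field
propagator"*).  [B1] (2.1)–(2.3) p. 608: the staircase contours `Γ_{y,x}`, the composite contours `Γ^{(k)}_{y,x} = Γ_{y,x_{k−1}} ∪ … ∪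
Γ_{x_1,x}`, and `A(Γ) = Σ_{b⊂Γ} A_b` (B3 (1.3): *"for an arbitrary vector field A defined on η-lattice and an arbitrary contour Γ of this
lattice we put A(Γ) = Σ_{b⊂Γ} ηA_b"*).

WHAT IS REPRODUCED (kind «located member», G.1 of `HOME/PHASE2-TARGETS.md`).  On the torus `T_ε = HiggsLattice.Site P 0` of an
arbitrary volume `P = (d, ε, K, L, M, L′_μ)`:
* §1 the frame map `dirIx : Fin d ≃ Ix d` (bond direction ↔ internal index of the `N = d` field in the tree's orthonormal site frame `cb`
  of `B1Eq230FluctCov`), the vector-field scale pieces `vecPieceOp P m² a k j := pieceR (zeroCharge d) T_ε 0 m² a k j` (r14's region pieces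
  at `Ω = T_ε`, `A = 0`, `N = d`), their bond kernel `vecKer` (the matrix entry between `(b′₋, ν(b′))` and `(b₋, μ(b))`), the AVERAGED KERNEL
  **`gsumV m² a k j x b := (Γ^{(j+1)}_{x_{j+1},x})(b′ ↦ ε·vecKer j b′ b)`** — literally the tree's contour functional `multiContourSum` of
  [B1] (2.2)–(2.3) applied to the kernel column, i.e. `Σ_{b′⊂Γ^{(j+1)}_{x_{j+1},x}} ε G^η_{(j)}(b′, b)` = the covariance of the leg
  `A′^{(j),η}(Γ^{(j+1)}_{x_{j+1},x})` of (1.3) with `A′_b` — and `distBlockV j x b = ε·dist_T(B^j(x), b)` (both end-points of `b`);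
* §2 kernel bookkeeping: `abs_vecKer_le` (one matrix entry below r14's column norm sum), vanishing beyond `j = k − 1`, `distBlockV_le`;
* §3 **`abs_gsumV_le`**: from ANY value bound of the (2.10) shape on the columns of the pieces, the (2.12) shape for the averaged kernel
  with the constant `d·L·e^{δ₁L}·C` — print's «additional factor L^jη»: at most `d·L^{j+1}` bonds (`sum_steps_le`) of weight `ε` each
  (`ε·d·L^{j+1} = dL·(L^jε)`), each within `L^{j+1}` of `x` (`blockIter_stair_src` + `tdist_le_pow_mul_tdist_blockIter`, paid by `e^{δ₁L}`),
  and `dist(B^j(x), b) ≤ ε|x − b₋|`;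
* §4 the CARRIER `vecTorusKernels hL m² a k : ScaledKernels` (`Site = T_ε`, `Bond = PBond P 0`, `dist = ε|x − x′|`, `absG`/`absDG` = r14's
  column sums for `vecPieceOp` and its covariant derivative at `A = 0`, `absGavg = ε^{−d}|gsumV|`, `distBlock = distBlockV`; the (2.5)/(2.11)
  fields `0`) and **`ineq210_and_212_vectorTorus`**: for `d ≥ 1`, `L ≥ 2`, `a > 0`, `m² > 0` there are `K₀ ≥ 1` and `δ₁, C > 0` (functions of
  `d, L, a, m²`) such that for EVERY volume `P` with these `d, L` and `K₀ ∣ M`, every scale `1 ≤ k ≤ K` with `L^kε ≤ 1` and `3L^kK₀ ≤ 2L^KML′_μ`: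
  `Ineq210 δ₁ C ∧ Ineq212 δ₁ C` for `vecTorusKernels _ m² a k`; `ineq212_vectorTorus` alone;
* §5 non-vacuity: the volume hypotheses are met by an explicit volume for every `K₀ ≥ 1` (`hypotheses_nonvacuous`), hence the binders of
  the theorem are inhabited (`ineq212_vectorTorus_witness`).

HONEST SCOPE / DECLARED DIVERGENCES (F7).  (i) The hypotheses are those of the input (a): `m² > 0` (print's vector mass `μ₀² > 0` is a
standing assumption of [B1] p. 605, so this is inside print), `K₀ ∣ M` and `3L^kK₀ ≤ |T_ε|_μ/ε` for a `K₀` depending on `d, L, a, m²` (a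
sub-family of print's volumes: print's `M` is «a sufficiently large natural number», not a multiple of a given one), `L^kε ≤ 1`, `1 ≤ k ≤ K`;
the constants depend on `K₀` through the inputs.  p03's `B3Ineq212ZeroTorus` covers the complementary sub-family (odd `L`, cubic tori
`L_μ = L^m`, every `m² ≥ 0`, no `K₀`).  (ii) `|·| =` the sup torus distance (1.3) `HiggsLattice.Site.tdist` in lattice units times `ε`;
`dist(B^j(x), b) = ε·min_{z ∈ B^j(x)} min(|z − b₋|, |z − b₊|)`.  (iii) The vector index of a bond is read in the tree's orthonormal site frame
`cb` through `dirIx` (the frame of the tree's kernel statements, e.g. (I.2.34) `|mat (fluctCovA …) s t|`); at `A = 0` the `N = d` operator is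
the scalar one on each component, so the choice of frame is immaterial for print's object, and the bound proved does not use it.  (iv) The
(2.5)/(2.11) fields of the carrier are `0` (nothing claimed).  (v) ROUTE = print's («an additional factor L^jη» on top of (2.10)); (2.10) is
r14's theorem BY NAME at `Ω = T_ε` (`isBigBlockUnion_univ`, every point interior), `A = 0` (`δ_A = 0`), charge `zeroCharge d` (`e = 0 ≤ E₀`).
No `def … : Prop`, no new named fact (`dirIx`, `vecPieceOp`, `vecKer`, `gsumV`, `distBlockV`, `vecTorusKernels` are concrete definitions; the
theorems are proved); standard axioms.  Value = kernel certificate of a located by-reference step of B3 on the paper's own lattice for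
the general volume family, NOT summit progress.
Unit `lit-balaban-p33-g57` (Phase-2 proof seat p33, gen 57); HOME `run/shared/lean/pub/lit-balaban/` (row B3.Eq2.12, FILED.md, STATUS.md).
-/

noncomputable section

open scoped BigOperators

namespace Literature.MathematicalPhysics.QuantumFieldTheory.Balaban1983to89.B3Ineq212VectorTorus

open HiggsLattice (ChargeData ScalarField covDeriv)
open HiggsAveraging (blockIter blockK mem_blockK toFinest multiContourSum shiftN)
open B1Eq230FluctCov (mat Ix cb)
open B3MultiscaleFields (zeroCharge)
open B3Sect2StatementsPart2 (ScaledKernels)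
open B3Ineq210RegularRegion (pieceR pieceR_of_le Interior ineq210_regularRegion_explicit)
open B3Ineq210RegularTorus (abs_mat_le_norm mesh_eq_pow_mul tdist_le_pow_mul_tdist_blockIter)
open B2Ineq329PrismHolonomy (abs_multiContourSum_le sum_steps_le blockIter_stair_src)
open B2Ineq329ZeroAveraging (multiContourSum_zero_field)
open B2Restr216Lattice (cornerN)
open B1TorusCubeCover (half)
open B1TorusRegionHSizes (isBigBlockUnion_univ)
open B1Ineq234LevelZero (tdist_comm tdist_triangle_real)
open B1Ineq234Concrete (tdist_self)

variable {P : HiggsLattice.Params}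

/-! ## §1 The vector-field scale pieces on `T_ε`, their bond kernel, the averaged kernel of (2.12), and `dist(B^j(x), b)` -/

/-- The vector index `μ` of a bond read as an internal index of the `N = d` field in the tree's orthonormal site frame
(`B1Eq230FluctCov.cb`, `Ix d = Fin (dim ℝ^d)`): [B1] p. 608 *"taking N = d and an external vector field A = 0"*, B3 p. 416 *"internal
indices and vector indices are understood here"*. [cite: Balaban1982Higgs1, p.608] -/
def dirIx (P : HiggsLattice.Params) : Fin P.d ≃ Ix P.d :=
  finCongr (finrank_euclideanSpace_fin (𝕜 := ℝ) (n := P.d)).symm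

variable (P) in
/-- **The scale pieces `G^η_{(j)}` of the VECTOR-FIELD propagator `G_k` of B3 p. 414** (*"the field A′ has the covariance G_k"*): the
pieces of (2.6) = (I.2.43) (p. 424 *"and the similar equality for the vector field propagator"*) for the `N = d` field on the WHOLE torus
`T_ε` at zero background ([B1] p. 608), i.e. r14's region pieces `pieceR` at `Ω = T_ε`, `A = 0`, charge data `zeroCharge d` (all
transports `= 1`). [cite: Balaban1983Higgs3, (2.6) p.424] -/
def vecPieceOp (msq a : ℝ) (k j : ℕ) : ScalarField P 0 P.d →ₗ[ℝ] ScalarField P 0 P.d :=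
  pieceR (zeroCharge P.d) (Finset.univ : Finset (HiggsLattice.Site P 0)) (0 : HiggsLattice.VecField P 0) msq a k j

/-- The kernel `G^η_{(j)}(b′, b)` of the `j`-th vector-field piece between the bonds `b′ = ⟨b′₋, b′₋ + εe_ν⟩` and `b = ⟨b₋, b₋ + εe_μ⟩`: the
matrix entry of `vecPieceOp` between `(b′₋, ν)` and `(b₋, μ)` in the tree's site frame. [cite: Balaban1983Higgs3, (2.12) p.426] -/
def vecKer (msq a : ℝ) (k j : ℕ) (b' b : HiggsLattice.PBond P 0) : ℝ :=
  mat (vecPieceOp P msq a k j) (b'.src, dirIx P b'.dir) (b.src, dirIx P b.dir)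

/-- **`G^η_{(j)}(Γ^{(j+1)}_{x_{j+1},x}, b)`**: the vector leg `A′^{(j),η}(Γ^{(j+1)}_{x_{j+1},x}) = Σ_{b′⊂Γ} εA′_{b′}` of (1.3) contracted with `A′_b`,
`Σ_{b′ ⊂ Γ^{(j+1)}_{x_{j+1},x}} ε·G^η_{(j)}(b′, b)` — the tree's composite-contour functional `HiggsAveraging.multiContourSum` of [B1] (2.2)–(2.3)
(`A ↦ A(Γ^{(j+1)}_{x_{j+1},x})`, all bonds positively oriented) applied to the kernel column `b′ ↦ ε·G^η_{(j)}(b′, b)`.  B3 p. 426: *"If a leg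
A′ of the line is in one of the vertices (1.14) and (1.15), then we have the expression A′^{(j),η}(Γ^{j+1}_{x_{j+1},x}) on the basis of (1.3)"*.
[cite: Balaban1983Higgs3, (2.12) p.426] [cite: Balaban1982Higgs1, (2.2)–(2.3) p.608] -/
def gsumV (msq a : ℝ) (k j : ℕ) (x : HiggsLattice.Site P 0) (b : HiggsLattice.PBond P 0) : ℝ :=
  multiContourSum (fun b' : HiggsLattice.PBond P 0 => P.mesh 0 * vecKer msq a k j b' b) (j + 1) x

/-- `x ∈ B^j(x)` (the block of level `j` through `x`). [cite: Balaban1982Higgs1, (1.20) p.607] -/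
theorem self_mem_blockK (j : ℕ) (x : HiggsLattice.Site P 0) : x ∈ blockK j (blockIter j x) :=
  (mem_blockK j _ x).mpr rfl

/-- `dist(B^j(x), b)` (in `ε`-units): `ε` times the sup torus distance (1.3) between the point set `B^j(x)` and the two end-points `b₋`,
`b₊` of the bond `b`. [cite: Balaban1983Higgs3, (2.12) p.426] -/
def distBlockV (j : ℕ) (x : HiggsLattice.Site P 0) (b : HiggsLattice.PBond P 0) : ℝ :=
  P.mesh 0 * (((blockK j (blockIter j x)).inf' ⟨x, self_mem_blockK j x⟩
    fun z => min (HiggsLattice.Site.tdist z b.src) (HiggsLattice.Site.tdist z b.tgt) : ℕ) : ℝ)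

/-! ## §2 Kernel bookkeeping -/

section Kernel

variable {msq a : ℝ} {k : ℕ}

/-- One matrix entry of a piece is below r14's column sum `Σ_{i′}‖(G^η_{(j)}e_{(b₋,i′)})(b′₋)‖` (one orthonormal coordinate is at most
the norm; one nonnegative term is at most the sum). [cite: Balaban1983Higgs3, (2.10) p.426] -/
theorem abs_vecKer_le (j : ℕ) (b' b : HiggsLattice.PBond P 0) :
    |vecKer msq a k j b' b| ≤ ∑ i' : Ix P.d, ‖vecPieceOp P msq a k j (cb P P.d 0 (b.src, i')) b'.src‖ := by
  unfold vecKer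
  refine (abs_mat_le_norm _ _ _).trans ?_
  exact Finset.single_le_sum (f := fun i' : Ix P.d => ‖vecPieceOp P msq a k j (cb P P.d 0 (b.src, i')) b'.src‖)
    (fun i' _ => norm_nonneg _) (Finset.mem_univ (dirIx P b.dir))

/-- No pieces beyond `j = k − 1`: the bond kernel vanishes for `1 ≤ j`, `k ≤ j`. [cite: Balaban1983Higgs3, (2.6) p.424] -/
theorem vecKer_of_le {j : ℕ} (hj1 : 1 ≤ j) (hkj : k ≤ j) (b' b : HiggsLattice.PBond P 0) : vecKer msq a k j b' b = 0 := by
  unfold vecKer vecPieceOp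
  rw [pieceR_of_le hj1 hkj, mat, map_zero]
  rfl

/-- Hence the averaged kernel vanishes for `1 ≤ j`, `k ≤ j`. [cite: Balaban1983Higgs3, (2.6) p.424] -/
theorem gsumV_of_le {j : ℕ} (hj1 : 1 ≤ j) (hkj : k ≤ j) (x : HiggsLattice.Site P 0) (b : HiggsLattice.PBond P 0) :
    gsumV msq a k j x b = 0 := by
  unfold gsumV
  have h : (fun b' : HiggsLattice.PBond P 0 => P.mesh 0 * vecKer msq a k j b' b) = (0 : HiggsLattice.VecField P 0) := by
    funext b'
    rw [vecKer_of_le hj1 hkj, mul_zero]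
    rfl
  rw [h]
  exact multiContourSum_zero_field _ _

/-- `dist(B^j(x), b) ≤ ε|x − b₋|` (`x ∈ B^j(x)`). [cite: Balaban1983Higgs3, (2.12) p.426] -/
theorem distBlockV_le (j : ℕ) (x : HiggsLattice.Site P 0) (b : HiggsLattice.PBond P 0) :
    distBlockV j x b ≤ P.mesh 0 * (HiggsLattice.Site.tdist x b.src : ℝ) := by
  unfold distBlockV
  refine mul_le_mul_of_nonneg_left ?_ (P.mesh_pos 0).le
  exact_mod_cast (Finset.inf'_le _ (self_mem_blockK j x)).trans (min_le_left _ _)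

/-- `0 ≤ dist(B^j(x), b)`. [cite: Balaban1983Higgs3, (2.12) p.426] -/
theorem distBlockV_nonneg (j : ℕ) (x : HiggsLattice.Site P 0) (b : HiggsLattice.PBond P 0) : 0 ≤ distBlockV j x b :=
  mul_nonneg (P.mesh_pos 0).le (Nat.cast_nonneg _)

end Kernel

/-! ## §3 «An additional factor `L^jη`»: the (2.12) shape for the averaged kernel from a (2.10)-type value bound on the pieces -/

section Averaged

variable {msq a : ℝ} {k : ℕ}

/-- kernel: `(L^jε)^{−1}·(ε·t) = t/L^j`. [folklore] -/
private theorem inv_mesh_mul (j : ℕ) (t : ℝ) : (P.mesh j)⁻¹ * (P.mesh 0 * t) = t / (P.L : ℝ) ^ j := by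
  have hε : P.mesh 0 ≠ 0 := (P.mesh_pos 0).ne'
  rw [mesh_eq_pow_mul P j, mul_inv, div_eq_mul_inv]
  calc ((P.L : ℝ) ^ j)⁻¹ * (P.mesh 0)⁻¹ * (P.mesh 0 * t) = t * ((P.L : ℝ) ^ j)⁻¹ * ((P.mesh 0)⁻¹ * P.mesh 0) := by ring
    _ = t * ((P.L : ℝ) ^ j)⁻¹ := by rw [inv_mul_cancel₀ hε, mul_one]

/-- kernel: `(L^jε)·(L^jε)^{2−d} = (L^jε)^{3−d}` (real exponents). [folklore] -/
private theorem mesh_mul_rpow (j : ℕ) :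
    P.mesh j * P.mesh j ^ ((2 : ℝ) - (P.d : ℝ)) = P.mesh j ^ ((3 : ℝ) - (P.d : ℝ)) := by
  rw [show (3 : ℝ) - (P.d : ℝ) = 1 + ((2 : ℝ) - (P.d : ℝ)) by ring, Real.rpow_add (P.mesh_pos j), Real.rpow_one]

/-- **The bonds of `Γ^{(j+1)}_{x_{j+1},x}` are within `L^{j+1}` of `x`** (sup torus distance, lattice units): they start in the block `B^{j+1}(x)`
(`blockIter_stair_src`), and two points of one `L^{j+1}`-block are `≤ L^{j+1} − 1` apart (`tdist_le_pow_mul_tdist_blockIter`).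
[cite: Balaban1982Higgs1, (2.2) p.608] -/
theorem tdist_stair_src_le {j i : ℕ} (hij : i < j + 1) (hj : j + 1 ≤ P.K) (x : HiggsLattice.Site P 0) (ν : Fin P.d) {s : ℕ}
    (hs : s < ((toFinest (blockIter i x)) ν - (toFinest (blockIter (i + 1) x)) ν).val) :
    (HiggsLattice.Site.tdist x
        (shiftN (cornerN (toFinest (blockIter (i + 1) x)) (toFinest (blockIter i x)) (ν + 1)) ν s) : ℝ)
      ≤ (P.L : ℝ) ^ (j + 1) := by
  set z := shiftN (cornerN (toFinest (blockIter (i + 1) x)) (toFinest (blockIter i x)) (ν + 1)) ν s with hz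
  have hblk : blockIter (j + 1) z = blockIter (j + 1) x := blockIter_stair_src hij hj x ν hs
  have h := tdist_le_pow_mul_tdist_blockIter hj z x
  rw [hblk, tdist_self, mul_zero, zero_add] at h
  rw [tdist_comm]
  have h1 : HiggsLattice.Site.tdist z x ≤ P.L ^ (j + 1) := h.trans (Nat.sub_le _ _)
  exact_mod_cast h1

/-- **(2.12) from (2.10), «an additional factor L^jη»**.  If the columns of the pieces obey a value bound of the (2.10) shape,
`ε^{−d}Σ_{i′}‖(G^η_{(j)}e_{(y,i′)})(z)‖ ≤ C(L^jε)^{2−d}e^{−δ₁(L^jε)^{−1}ε|z−y|}` (all `j, z, y`), then for `1 ≤ k ≤ K`, every `j`, `x ∈ T_ε` and bond `b`: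
`ε^{−d}|G^η_{(j)}(Γ^{(j+1)}_{x_{j+1},x}, b)| ≤ (dLe^{δ₁L}C)(L^jε)^{3−d}e^{−δ₁(L^jε)^{−1}dist(B^j(x),b)}` — at most `d·L^{j+1}` bonds (`sum_steps_le`) of
weight `ε` each, each bounded by the value bound at a point within `L^{j+1}` of `x` (`tdist_stair_src_le`, paid by `e^{δ₁L}`), and
`dist(B^j(x), b) ≤ ε|x − b₋|` (`distBlockV_le`); no bonds contribute for `j ≥ k` (`gsumV_of_le`). [cite: Balaban1983Higgs3, (2.12) p.426] -/
theorem abs_gsumV_le (hk1 : 1 ≤ k) (hkK : k ≤ P.K) {δ₁ C : ℝ} (hδ₁ : 0 < δ₁) (hC : 0 ≤ C)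
    (hval : ∀ (j : ℕ) (z y : HiggsLattice.Site P 0),
      (P.mesh 0 ^ P.d)⁻¹ * ∑ i' : Ix P.d, ‖vecPieceOp P msq a k j (cb P P.d 0 (y, i')) z‖
        ≤ C * P.mesh j ^ ((2 : ℝ) - (P.d : ℝ)) *
          Real.exp (-(δ₁ * (P.mesh j)⁻¹ * (P.mesh 0 * (HiggsLattice.Site.tdist z y : ℝ)))))
    (j : ℕ) (x : HiggsLattice.Site P 0) (b : HiggsLattice.PBond P 0) :
    (P.mesh 0 ^ P.d)⁻¹ * |gsumV msq a k j x b|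
      ≤ ((P.d : ℝ) * (P.L : ℝ) * Real.exp (δ₁ * P.L) * C) * P.mesh j ^ ((3 : ℝ) - (P.d : ℝ)) *
          Real.exp (-(δ₁ * (P.mesh j)⁻¹ * distBlockV j x b)) := by
  have hε := P.mesh_pos 0
  have hεd : 0 < P.mesh 0 ^ P.d := pow_pos hε _
  have hεd' : 0 < (P.mesh 0 ^ P.d)⁻¹ := inv_pos.2 hεd
  have hmj := P.mesh_pos j
  have hL0 : (0 : ℝ) < P.L := by exact_mod_cast P.hL
  have hLj : (0 : ℝ) < (P.L : ℝ) ^ j := pow_pos hL0 j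
  have hsr : 0 < P.mesh j ^ ((3 : ℝ) - (P.d : ℝ)) := Real.rpow_pos_of_pos hmj _
  rcases Nat.lt_or_ge j k with hjk | hkj
  · -- `j < k ≤ K`: the contour `Γ^{(j+1)}` sits at admissible levels `j + 1 ≤ K`
    have hjK : j + 1 ≤ P.K := by omega
    -- the value bound in the form `e^{−δ₁|z − y|/L^j}`, with the factor `ε^d` moved to the right
    have hval' : ∀ z y : HiggsLattice.Site P 0, ∑ i' : Ix P.d, ‖vecPieceOp P msq a k j (cb P P.d 0 (y, i')) z‖
        ≤ P.mesh 0 ^ P.d * (C * P.mesh j ^ ((2 : ℝ) - (P.d : ℝ)) *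
          Real.exp (-(δ₁ * ((HiggsLattice.Site.tdist z y : ℝ) / (P.L : ℝ) ^ j)))) := by
      intro z y
      have h := hval j z y
      rw [mul_assoc δ₁ ((P.mesh j)⁻¹), inv_mesh_mul j] at h
      rwa [← div_le_iff₀' hεd, div_eq_inv_mul]
    set E := Real.exp (-(δ₁ * ((HiggsLattice.Site.tdist x b.src : ℝ) / (P.L : ℝ) ^ j))) with hE
    have hE0 : 0 < E := Real.exp_pos _
    -- the weight of one bond of the contour
    set β := P.mesh 0 * (P.mesh 0 ^ P.d * (C * P.mesh j ^ ((2 : ℝ) - (P.d : ℝ)) * (Real.exp (δ₁ * P.L) * E))) with hβ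
    have hβ0 : 0 ≤ β := by positivity
    -- every bond of `Γ^{(j+1)}_{x_{j+1},x}` has weight `≤ β`
    have hB : ∀ i, i < j + 1 → ∀ (ν : Fin P.d) (s : ℕ),
        s < ((toFinest (blockIter i x)) ν - (toFinest (blockIter (i + 1) x)) ν).val →
        |(fun b' : HiggsLattice.PBond P 0 => P.mesh 0 * vecKer msq a k j b' b)
          ⟨shiftN (cornerN (toFinest (blockIter (i + 1) x)) (toFinest (blockIter i x)) (ν + 1)) ν s, ν⟩| ≤ β := by
      intro i hij ν s hs
      set z := shiftN (cornerN (toFinest (blockIter (i + 1) x)) (toFinest (blockIter i x)) (ν + 1)) ν s with hz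
      have hzx : (HiggsLattice.Site.tdist x z : ℝ) ≤ (P.L : ℝ) ^ (j + 1) := tdist_stair_src_le hij hjK x ν hs
      -- `e^{−δ₁|z − b₋|/L^j} ≤ e^{δ₁L}·e^{−δ₁|x − b₋|/L^j}`
      have hcmp : Real.exp (-(δ₁ * ((HiggsLattice.Site.tdist z b.src : ℝ) / (P.L : ℝ) ^ j)))
          ≤ Real.exp (δ₁ * P.L) * E := by
        rw [hE, ← Real.exp_add]
        refine Real.exp_le_exp.2 ?_
        have htri := tdist_triangle_real x z b.src
        have key : (HiggsLattice.Site.tdist x b.src : ℝ) / (P.L : ℝ) ^ j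
            - (HiggsLattice.Site.tdist z b.src : ℝ) / (P.L : ℝ) ^ j ≤ P.L := by
          rw [← sub_div, div_le_iff₀ hLj]
          calc (HiggsLattice.Site.tdist x b.src : ℝ) - (HiggsLattice.Site.tdist z b.src : ℝ)
              ≤ (P.L : ℝ) ^ (j + 1) := by linarith
            _ = (P.L : ℝ) * (P.L : ℝ) ^ j := by rw [pow_succ]; ring
        nlinarith [mul_le_mul_of_nonneg_left key hδ₁.le]
      show |P.mesh 0 * vecKer msq a k j ⟨z, ν⟩ b| ≤ β
      rw [abs_mul, abs_of_pos hε, hβ]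
      refine mul_le_mul_of_nonneg_left ?_ hε.le
      calc |vecKer msq a k j ⟨z, ν⟩ b|
          ≤ ∑ i' : Ix P.d, ‖vecPieceOp P msq a k j (cb P P.d 0 (b.src, i')) z‖ := abs_vecKer_le j ⟨z, ν⟩ b
        _ ≤ P.mesh 0 ^ P.d * (C * P.mesh j ^ ((2 : ℝ) - (P.d : ℝ)) *
              Real.exp (-(δ₁ * ((HiggsLattice.Site.tdist z b.src : ℝ) / (P.L : ℝ) ^ j)))) := hval' z b.src
        _ ≤ P.mesh 0 ^ P.d * (C * P.mesh j ^ ((2 : ℝ) - (P.d : ℝ)) * (Real.exp (δ₁ * P.L) * E)) :=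
            mul_le_mul_of_nonneg_left (mul_le_mul_of_nonneg_left hcmp (by positivity)) hεd.le
    -- the contour has at most `d·L^{j+1}` bonds
    have hlen : (∑ i ∈ Finset.range (j + 1), ∑ ν : Fin P.d,
        (((toFinest (blockIter i x)) ν - (toFinest (blockIter (i + 1) x)) ν).val : ℝ)) ≤ (P.d : ℝ) * (P.L : ℝ) ^ (j + 1) := by
      refine (sum_steps_le hjK x).trans ?_
      have hd0 : (0 : ℝ) ≤ P.d := Nat.cast_nonneg _
      nlinarith
    have hsum := abs_multiContourSum_le (fun b' : HiggsLattice.PBond P 0 => P.mesh 0 * vecKer msq a k j b' b) (j + 1) x hB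
    have hdist : E ≤ Real.exp (-(δ₁ * (P.mesh j)⁻¹ * distBlockV j x b)) := by
      rw [hE]
      refine Real.exp_le_exp.2 (neg_le_neg ?_)
      rw [mul_assoc]
      refine mul_le_mul_of_nonneg_left ?_ hδ₁.le
      rw [← inv_mesh_mul j]
      exact mul_le_mul_of_nonneg_left (distBlockV_le j x b) (inv_pos.2 hmj).le
    calc (P.mesh 0 ^ P.d)⁻¹ * |gsumV msq a k j x b|
        ≤ (P.mesh 0 ^ P.d)⁻¹ * ((∑ i ∈ Finset.range (j + 1), ∑ ν : Fin P.d,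
            (((toFinest (blockIter i x)) ν - (toFinest (blockIter (i + 1) x)) ν).val : ℝ)) * β) :=
          mul_le_mul_of_nonneg_left hsum hεd'.le
      _ ≤ (P.mesh 0 ^ P.d)⁻¹ * (((P.d : ℝ) * (P.L : ℝ) ^ (j + 1)) * β) :=
          mul_le_mul_of_nonneg_left (mul_le_mul_of_nonneg_right hlen hβ0) hεd'.le
      _ = (P.d : ℝ) * (P.L : ℝ) * Real.exp (δ₁ * P.L) * C * (((P.L : ℝ) ^ j * P.mesh 0) * P.mesh j ^ ((2 : ℝ) - (P.d : ℝ)))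
            * E * ((P.mesh 0 ^ P.d)⁻¹ * P.mesh 0 ^ P.d) := by
          rw [hβ, pow_succ]; ring
      _ = (P.d : ℝ) * (P.L : ℝ) * Real.exp (δ₁ * P.L) * C * P.mesh j ^ ((3 : ℝ) - (P.d : ℝ)) * E := by
          rw [← mesh_eq_pow_mul P j, mesh_mul_rpow, inv_mul_cancel₀ hεd.ne', mul_one]
      _ ≤ _ := mul_le_mul_of_nonneg_left hdist (by positivity)
  · -- `j ≥ k ≥ 1`: no piece, the averaged kernel vanishes
    rw [gsumV_of_le (hk1.trans hkj) hkj, abs_zero, mul_zero]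
    exact mul_nonneg (mul_nonneg (by positivity) hsr.le) (Real.exp_pos _).le

end Averaged

/-! ## §4 The carrier on `T_ε` for the general volume family and (2.10) ∧ (2.12) PROVED for it -/

/-- **The concrete carrier of B3 (2.10)/(2.12) for the VECTOR-FIELD propagator on the torus `T_ε` of an ARBITRARY volume
`P = (d, ε, K, L, M, L′_μ)` of [B1] (1.2)** at the scale `k`: sites `T_ε`, bonds = positively oriented bonds `⟨b₋, μ⟩` (`PBond P 0`),
`dist = ε|x − x′|` ((1.3)), `absG j x x′ = ε^{−d}Σ_{i′}‖(G^η_{(j)}e_{(x′,i′)})(x)‖` and `absDG` its covariant derivative at `A = 0` in the row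
variable (r14's columns for `vecPieceOp`), `absGavg j x b = ε^{−d}|G^η_{(j)}(Γ^{(j+1)}_{x_{j+1},x}, b)|` (`gsumV`), `distBlock j x b = dist(B^j(x), b)`
(`distBlockV`); the (2.5)/(2.11) fields stay unmodelled (`0`). [cite: Balaban1983Higgs3, (2.10), (2.12) p.426] -/
def vecTorusKernels {P : HiggsLattice.Params} (hL1 : 1 < P.L) (msq a : ℝ) (k : ℕ) : ScaledKernels where
  Site := HiggsLattice.Site P 0
  Bond := HiggsLattice.PBond P 0
  Dir := Fin P.d
  LocFn := PUnit
  dist := fun x x' => P.mesh 0 * (HiggsLattice.Site.tdist x x' : ℝ)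
  dist2 := fun _ _ _ => 0
  distBlock := fun j x b => distBlockV j x b
  distSupp := fun _ _ => 0
  distΩ₂ := 0
  L := P.L
  η := P.mesh 0
  d := P.d
  eRun := 0
  pRun := 0
  one_lt_L := by exact_mod_cast hL1
  η_pos := P.mesh_pos 0
  absG := fun j x x' => (P.mesh 0 ^ P.d)⁻¹ * ∑ i' : Ix P.d, ‖vecPieceOp P msq a k j (cb P P.d 0 (x', i')) x‖
  absDG := fun j μ x x' => (P.mesh 0 ^ P.d)⁻¹ *
    ∑ i' : Ix P.d, ‖covDeriv (zeroCharge P.d) (0 : HiggsLattice.VecField P 0) (vecPieceOp P msq a k j (cb P P.d 0 (x', i'))) ⟨x, μ⟩‖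
  holderDiff := fun _ _ _ _ _ => 0
  absGavg := fun j x b => (P.mesh 0 ^ P.d)⁻¹ * |gsumV msq a k j x b|
  normDeltaG := fun _ _ _ => 0
  norm116 := fun _ _ _ _ _ => 0

section Carrier

variable {hL1 : 1 < P.L} {msq a : ℝ} {k : ℕ}

/-- the carrier's `L^jη` is the model's `L^jε`. [cite: Balaban1983Higgs3, (2.12) p.426] -/
theorem scaleV_eq (j : ℕ) : (vecTorusKernels hL1 msq a k).scale j = P.mesh j := by
  show (P.L : ℝ) ^ j * P.mesh 0 = P.mesh j
  rw [mesh_eq_pow_mul P j]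

/-- **Transfer**: r14's explicit kernel bounds at all points of `T_ε` give `Ineq210` for the carrier, and (through `abs_gsumV_le`)
`Ineq212` with the constant `dLe^{δ₁L}·C`. [cite: Balaban1983Higgs3, (2.10), (2.12) p.426] -/
theorem ineq210_212_of_bounds (hk1 : 1 ≤ k) (hkK : k ≤ P.K) {δ₁ C : ℝ} (hδ₁ : 0 < δ₁) (hC : 0 ≤ C)
    (hval : ∀ (j : ℕ) (z y : HiggsLattice.Site P 0),
      (P.mesh 0 ^ P.d)⁻¹ * ∑ i' : Ix P.d, ‖vecPieceOp P msq a k j (cb P P.d 0 (y, i')) z‖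
        ≤ C * P.mesh j ^ ((2 : ℝ) - (P.d : ℝ)) *
          Real.exp (-(δ₁ * (P.mesh j)⁻¹ * (P.mesh 0 * (HiggsLattice.Site.tdist z y : ℝ)))))
    (hder : ∀ (j : ℕ) (μ : Fin P.d) (z y : HiggsLattice.Site P 0),
      (P.mesh 0 ^ P.d)⁻¹ * ∑ i' : Ix P.d,
          ‖covDeriv (zeroCharge P.d) (0 : HiggsLattice.VecField P 0) (vecPieceOp P msq a k j (cb P P.d 0 (y, i'))) ⟨z, μ⟩‖
        ≤ C * P.mesh j ^ ((1 : ℝ) - (P.d : ℝ)) *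
          Real.exp (-(δ₁ * (P.mesh j)⁻¹ * (P.mesh 0 * (HiggsLattice.Site.tdist z y : ℝ))))) :
    (vecTorusKernels hL1 msq a k).Ineq210 δ₁ C ∧
      (vecTorusKernels hL1 msq a k).Ineq212 δ₁ ((P.d : ℝ) * (P.L : ℝ) * Real.exp (δ₁ * P.L) * C) := by
  refine ⟨fun j x x' => ?_, fun j x b => ?_⟩
  · rw [scaleV_eq]
    exact ⟨hval j x x', fun μ => hder j μ x x'⟩
  · rw [scaleV_eq]
    exact abs_gsumV_le hk1 hkK hδ₁ hC hval j x b

end Carrier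

section Main

/-- weakening of the constant in (2.10). [cite: Balaban1983Higgs3, (2.10) p.426] -/
private theorem ineq210_mono {S : ScaledKernels} {δ₁ C C' : ℝ} (h : S.Ineq210 δ₁ C) (hC : C ≤ C') : S.Ineq210 δ₁ C' := by
  have hsc : ∀ j, 0 < S.scale j := fun j => mul_pos (pow_pos (lt_trans zero_lt_one S.one_lt_L) j) S.η_pos
  intro j x x'
  obtain ⟨h1, h2⟩ := h j x x'
  refine ⟨h1.trans ?_, fun μ => (h2 μ).trans ?_⟩
  · exact mul_le_mul_of_nonneg_right (mul_le_mul_of_nonneg_right hC (Real.rpow_nonneg (hsc j).le _)) (Real.exp_pos _).le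
  · exact mul_le_mul_of_nonneg_right (mul_le_mul_of_nonneg_right hC (Real.rpow_nonneg (hsc j).le _)) (Real.exp_pos _).le

/-- weakening of the constant in (2.12). [cite: Balaban1983Higgs3, (2.12) p.426] -/
private theorem ineq212_mono {S : ScaledKernels} {δ₁ C C' : ℝ} (h : S.Ineq212 δ₁ C) (hC : C ≤ C') : S.Ineq212 δ₁ C' := by
  have hsc : ∀ j, 0 < S.scale j := fun j => mul_pos (pow_pos (lt_trans zero_lt_one S.one_lt_L) j) S.η_pos
  intro j x b
  refine (h j x b).trans ?_
  exact mul_le_mul_of_nonneg_right (mul_le_mul_of_nonneg_right hC (Real.rpow_nonneg (hsc j).le _)) (Real.exp_pos _).le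

/-- **B3 (2.10) AND (2.12) p. 426 [PDF 16] PROVED FOR THE VECTOR-FIELD PROPAGATOR `G_k` ON THE TORUS `T_ε` OF THE GENERAL VOLUME FAMILY
of [B1] (1.2), uniformly in the volume and the scale.**  For `d ≥ 1`, `L ≥ 2`, `a > 0`, `m² > 0` there are `K₀ ≥ 1` and `δ₁ > 0`, `C > 0`
(functions of `d, L, a, m²`) such that for EVERY volume `P = (d, ε, K, L, M, L′_μ)` with these `d, L` and `K₀ ∣ M`, and every scale
`1 ≤ k ≤ K` with `3L^kK₀ ≤ 2L^KML′_μ` (all `μ`) and `L^kε ≤ 1`: `(vecTorusKernels _ m² a k).Ineq210 δ₁ C ∧ (vecTorusKernels _ m² a k).Ineq212 δ₁ C`,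
i.e. for all `j`, `x, x′ ∈ T_ε`, directions `μ` and bonds `b`:
`ε^{−d}Σ_{i′}‖(G^η_{(j)}e_{(x′,i′)})(x)‖ ≤ C(L^jε)^{2−d}e^{−δ₁(L^jε)^{−1}ε|x−x′|}` (and `(L^jε)^{1−d}` for the covariant derivative), and
`ε^{−d}|G^η_{(j)}(Γ^{(j+1)}_{x_{j+1},x}, b)| ≤ C(L^jε)^{3−d}e^{−δ₁(L^jε)^{−1}dist(B^j(x),b)}`.  Print: *"Of course the same inequalities hold for vector
field propagators … For each such expression we have an additional factor L^jη on the right side, e.g. we have (2.12)."*  Route: (2.10) =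
r14's `B3Ineq210RegularRegion.ineq210_regularRegion_explicit` at `Ω = T_ε` (a big-block union, every point interior), `A = 0` (`δ_A = 0`),
`N = d`, charge `zeroCharge d` (`e² = 0 ≤ E₀`); (2.12) from it by `abs_gsumV_le`. [cite: Balaban1983Higgs3, (2.10), (2.12) p.426]
[cite: Balaban1982Higgs1, Prop. 2.1 p.610, (2.2) p.608] -/
theorem ineq210_and_212_vectorTorus (d L : ℕ) (hd : 1 ≤ d) (hL : 2 ≤ L) {a : ℝ} (ha : 0 < a) {msq : ℝ} (hmsq : 0 < msq) :
    ∃ K₀ : ℕ, 1 ≤ K₀ ∧ ∃ δ₁ C : ℝ, 0 < δ₁ ∧ 0 < C ∧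
      ∀ (P : HiggsLattice.Params) (hP1 : 1 < P.L), P.d = d → P.L = L → K₀ ∣ P.M →
      ∀ {k : ℕ}, 1 ≤ k → k ≤ P.K → (∀ μ, 3 * half P k K₀ ≤ P.sitesPerDir 0 μ) → P.mesh k ≤ 1 →
        (vecTorusKernels hP1 msq a k).Ineq210 δ₁ C ∧ (vecTorusKernels hP1 msq a k).Ineq212 δ₁ C := by
  obtain ⟨E₀, hE₀, h⟩ := ineq210_regularRegion_explicit d L hd hL ha hmsq (c := 0) le_rfl d
  have he : (zeroCharge d).e ^ 2 ≤ E₀ := by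
    rw [show (zeroCharge d).e = 0 from rfl]
    simpa using hE₀.le
  obtain ⟨K₀min, h⟩ := h (zeroCharge d) he
  obtain ⟨t, δ₁, Cst, ht, hδ₁, hCst, h⟩ := h (max K₀min 1) (le_max_left _ _)
  have hL0 : (0 : ℝ) < L := by exact_mod_cast (by omega : 0 < L)
  have hd0 : (0 : ℝ) < d := by exact_mod_cast hd
  refine ⟨max K₀min 1, le_max_right _ _, δ₁, Cst * (1 + (d : ℝ) * (L : ℝ) * Real.exp (δ₁ * L)), hδ₁, by positivity, ?_⟩
  intro P hP1 hPd hPL hK₀M k hk1 hkK h3 hmesh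
  subst hPd hPL
  have hint : ∀ x : HiggsLattice.Site P 0, Interior k (max K₀min 1) (Finset.univ : Finset (HiggsLattice.Site P 0)) x :=
    fun x y _ => Finset.mem_univ y
  have hreg : ∀ z ∈ (Finset.univ : Finset (HiggsLattice.Site P 0)), ∀ μ ν : Fin P.d,
      |(0 : HiggsLattice.VecField P 0) ⟨z.shift ν, μ⟩ - (0 : HiggsLattice.VecField P 0) ⟨z, μ⟩| ≤ 0 := by
    intro z _ μ ν
    simp
  have ht' : (P.L : ℝ) ^ k * 0 * |(zeroCharge P.d).e| ≤ t := by
    rw [mul_zero, zero_mul]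
    exact ht.le
  have hc' : (P.L : ℝ) ^ k * 0 ≤ 0 * |(zeroCharge P.d).e| := by
    rw [mul_zero, zero_mul]
  have hK := h P hP1 rfl rfl hK₀M hk1 hkK h3 hmesh Finset.univ isBigBlockUnion_univ (0 : HiggsLattice.VecField P 0) le_rfl
    hreg ht' hc'
  have hboth := ineq210_212_of_bounds (hL1 := hP1) (msq := msq) (a := a) hk1 hkK hδ₁ hCst.le
    (fun j z y => (hK j z y (hint z) (hint y)).1) (fun j μ z y => (hK j z y (hint z) (hint y)).2 μ)
  have h1 : Cst ≤ Cst * (1 + (P.d : ℝ) * (P.L : ℝ) * Real.exp (δ₁ * P.L)) := by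
    have : (1 : ℝ) ≤ 1 + (P.d : ℝ) * (P.L : ℝ) * Real.exp (δ₁ * P.L) := by
      have : 0 ≤ (P.d : ℝ) * (P.L : ℝ) * Real.exp (δ₁ * P.L) := by positivity
      linarith
    nlinarith
  have h2 : (P.d : ℝ) * (P.L : ℝ) * Real.exp (δ₁ * P.L) * Cst ≤ Cst * (1 + (P.d : ℝ) * (P.L : ℝ) * Real.exp (δ₁ * P.L)) := by
    nlinarith
  exact ⟨ineq210_mono hboth.1 h1, ineq212_mono hboth.2 h2⟩

/-- **B3 (2.12) p. 426 alone, for the vector-field propagator on the torus of the general volume family.**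
[cite: Balaban1983Higgs3, (2.12) p.426] -/
theorem ineq212_vectorTorus (d L : ℕ) (hd : 1 ≤ d) (hL : 2 ≤ L) {a : ℝ} (ha : 0 < a) {msq : ℝ} (hmsq : 0 < msq) :
    ∃ K₀ : ℕ, 1 ≤ K₀ ∧ ∃ δ₁ C : ℝ, 0 < δ₁ ∧ 0 < C ∧
      ∀ (P : HiggsLattice.Params) (hP1 : 1 < P.L), P.d = d → P.L = L → K₀ ∣ P.M →
      ∀ {k : ℕ}, 1 ≤ k → k ≤ P.K → (∀ μ, 3 * half P k K₀ ≤ P.sitesPerDir 0 μ) → P.mesh k ≤ 1 →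
        (vecTorusKernels hP1 msq a k).Ineq212 δ₁ C := by
  obtain ⟨K₀, hK₀, δ₁, C, hδ₁, hC, h⟩ := ineq210_and_212_vectorTorus d L hd hL ha hmsq
  exact ⟨K₀, hK₀, δ₁, C, hδ₁, hC, fun P hP1 hPd hPL hK₀M k hk1 hkK h3 hmesh => (h P hP1 hPd hPL hK₀M hk1 hkK h3 hmesh).2⟩

end Main

/-! ## §5 Non-vacuity: the volume hypotheses are met, so the binders of the theorem are inhabited -/

section Witness

/-- For every `d ≥ 1`, `L ≥ 2` and `K₀ ≥ 1` there is a volume of [B1] (1.2) meeting the hypotheses of `ineq210_and_212_vectorTorus` at the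
scale `k = 1`: `ε = 1/L`, `K = 1`, `M = K₀`, `L′_μ = 2` (so `|T_ε|_μ/ε = 4LK₀ ≥ 3LK₀` and `Lε = 1`). [cite: Balaban1982Higgs1, (1.2) p.604] -/
theorem hypotheses_nonvacuous (d L K₀ : ℕ) (hd : 1 ≤ d) (hL : 2 ≤ L) (hK₀ : 1 ≤ K₀) :
    ∃ P : HiggsLattice.Params, 1 < P.L ∧ P.d = d ∧ P.L = L ∧ K₀ ∣ P.M ∧ 1 ≤ P.K ∧
      (∀ μ, 3 * half P 1 K₀ ≤ P.sitesPerDir 0 μ) ∧ P.mesh 1 ≤ 1 := by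
  have hL0 : (0 : ℝ) < L := by exact_mod_cast (by omega : 0 < L)
  refine ⟨⟨d, (L : ℝ)⁻¹, 1, L, K₀, fun _ => 2, hd, inv_pos.2 hL0, by omega, by omega, fun _ => by norm_num⟩,
    by show 1 < L; omega, rfl, rfl, dvd_rfl, le_rfl, fun μ => ?_, ?_⟩
  · show 3 * (L ^ 1 * K₀) ≤ 2 * (L ^ (1 - 0) * K₀ * 2)
    simp only [pow_one, Nat.sub_zero]
    nlinarith
  · show (L : ℝ) ^ 1 * (L : ℝ)⁻¹ ≤ 1
    rw [pow_one, mul_inv_cancel₀ hL0.ne']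

/-- **The constants exist and (2.10) ∧ (2.12) hold for an explicit volume of the general family** (`d = 3`, `L = 2` — an EVEN block size,
outside the scalar torus tower of `B3Ineq212ZeroTorus` — `a = 1`, `m² = 1`, scale `k = 1`). [cite: Balaban1983Higgs3, (2.12) p.426] -/
theorem ineq212_vectorTorus_witness :
    ∃ (δ₁ C : ℝ) (P : HiggsLattice.Params) (hP1 : 1 < P.L), 0 < δ₁ ∧ 0 < C ∧ P.d = 3 ∧ P.L = 2 ∧
      (vecTorusKernels hP1 1 1 1).Ineq210 δ₁ C ∧ (vecTorusKernels hP1 1 1 1).Ineq212 δ₁ C := by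
  obtain ⟨K₀, hK₀, δ₁, C, hδ₁, hC, h⟩ :=
    ineq210_and_212_vectorTorus 3 2 (by norm_num) le_rfl (a := 1) one_pos (msq := 1) one_pos
  obtain ⟨P, hP1, hPd, hPL, hM, hK, h3, hmesh⟩ := hypotheses_nonvacuous 3 2 K₀ (by norm_num) le_rfl hK₀
  exact ⟨δ₁, C, P, hP1, hδ₁, hC, hPd, hPL, h P hP1 hPd hPL hM le_rfl hK h3 hmesh⟩

end Witness

end Literature.MathematicalPhysics.QuantumFieldTheory.Balaban1983to89.B3Ineq212VectorTorus

end
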